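import Summits.CriticalPhenomena.SAWScalingLimit.Theses.SAWLoopLift

/-!
# Birth skeleton (`Lines/birth.lean`) for crux `BoundaryMixing` (stmt-CriticalPhenomena-4847)

Route `SAWLoopLift` of `CriticalPhenomena/SAWScalingLimit`, crux r3 `BoundaryMixing` — CUTTING
ALONG `∂Ω`, LATTICE SIDE: for every Dobrushin domain `(Ω; a, b)`, endpoint approximation
`(a_δ, b_δ)`, window `B(0,R) ⊇ Ω̄`, compact regular-closed `K ⊆ Ω` and `η > 0` there is a gate size
`ε₀` such that for every `ε ∈ (0, ε₀)`, eventually as `δ → 0⁺`,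
`|P_δ^{SAW(Ω_δ; a_δ, b_δ)}(γ ∩ K = ∅) − ν_δ(G_ε ∩ {T ∩ K = ∅}) / ν_δ(G_ε)| < η`, where `ν_δ` is the
critical polygon gas of `δℤ²` (mass `x_c^{#P}` per polygon, events read on closed-edge traces) and
`G_ε` the two-gate event of the crux (trace in `B(0,R)`, no contact with `∂Ω` outside
`B(a,ε) ∪ B(b,ε)`, macroscopic inside and outside, both gates met).

## The line (the route header's own "NOT DECOMPOSED YET" plan for C3, typed: cutting identity +
near-endpoint mixing; the `IsEndpointApprox` link is PROVED glue)

Vocabulary (§1) is the crux's inlined `let`-terms VERBATIM (`trace`, `mass`, `gate`) plus two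
abbreviations: `avoidProb Ω' δ u v K = P^{SAW(Ω'_δ; u, v)}(range γ ∩ K = ∅)` (the crux's own
left-hand term when `Ω' = Ω`, `u = a_δ`, `v = b_δ`) and PINNING DATA `IsPinning D ρ δ Ω' u v`:
a sub-domain `Ω' ⊆ Ω` that agrees with `Ω` off the closed `ρ`-gates
(`Ω ∖ closure(B(a,ρ) ∪ B(b,ρ)) ⊆ Ω'`), lattice endpoints `u, v` whose mesh points lie in the
`ρ`-gates at `a` resp. `b`, joined in `Ω'_δ` (so `SAW.law Ω' δ u v` is an honest probability law).
Pinning data are exactly what the cutting of a polygon along `∂Ω` produces: the macroscopic inside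
arc of a gate-crossing polygon is a self-avoiding walk of `Ω_δ` MINUS the vertices of the other
(gate-confined) inside pieces, between the first and last lattice vertices inside `Ω`.

* `stub_gateMixture : GateMixture` (L) — THE CUTTING IDENTITY, averaged: for small `ε`, eventually
  in `δ`, the gas ratio `q_ε(δ) = ν_δ(G_ε ∩ avoid K)/ν_δ(G_ε)` lies within `η` of the range of the
  gate-pinned chordal avoidance probabilities: there are pinning data `g₁, g₂` at gate radius `2ε`
  with `P^{g₁}(avoid K) − η ≤ q_ε(δ) ≤ P^{g₂}(avoid K) + η`.  Mechanism: a polygon of `G_ε` with a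
  single macroscopic inside passage is (macroscopic inside SAW `ω`) ⊕ (rest `ρ`), weights multiply
  (`x_c^{#P} = x_c^{|ω|} · x_c^{#ρ}`), and given `ρ` the admissible `ω` are the SAWs of
  `(Ω ∖ V(ρ))_δ` between the pinned endpoints, `K`-avoidance being read on `ω` alone — so the
  single-passage part of `q_ε(δ)` is an exact convex combination of conditional pinned avoidance
  probabilities (KennedyLawler2013 §1.2, chordal twin of the cut-curve ensemble; LSW04 §3.4.5).
  The slack `η` carries three named error terms, each a genuine estimate: (i) multi-passage /
  bubble gate configurations (≥ 2 macroscopic inside components) are `o_ε(1)·ν_δ(G_ε)` uniformly in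
  small `δ` (extra boundary legs: half-plane SAW exponents `x̃₂ = 2 > 2·x̃₁ = 5/4`) — the item's
  recorded "why it might fail" no. 2; (ii) walks of `Ω'_δ` using a closed lattice edge that
  touches `∂Ω` away from the gates (allowed by `SAW.law`, forbidden on the gas side by `G_ε`) have
  conditional effect `o_δ(1)` on the macroscopic event; (iii) existence of `G_ε`-polygons for small
  `δ` (so that `q_ε(δ)` is not the junk `0/0`).
* `stub_pinningMixing : PinningMixing` (XL, HARDEST — the item's "why it might fail" no. 1): for
  small `ε`, eventually in `δ`, ALL pinning data at gate radius `ε` give the same avoidance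
  probability up to `η`: `|P^{g₁}(avoid K) − P^{g₂}(avoid K)| < η`.  The macroscopic critical SAW
  forgets how it is pinned near `a` and `b` (which lattice endpoints inside the gates, which
  gate-local excision of the domain): a near-endpoint RATIO-MIXING statement for the critical
  `ℤ²` SAW, uniform over the pinning.  No polygon, no gas, no SLE enters.
* PROVED glue (no `sorry`): `eventually_isPinning` — under `SAW.IsEndpointApprox D a b` the
  reference data `(Ω; a_δ, b_δ)` are themselves pinning data at every gate radius `ρ > 0`,
  eventually in `δ` (mesh points converge to `a`, `b`; joined in `Ω_δ` eventually) — this is where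
  the crux's "general endpoint approximation (depth ≫ δ, tangential approach) is included" is
  discharged; and the composition `BoundaryMixing_of` (an `η/2`-argument on `𝓝[>] 0`:
  `P^{(Ω;a_δ,b_δ)} ≥ P^{g₂} − η/2 ≥ q − η` and symmetrically), concluding the route decl BY NAME
  through `boundaryMixing_iff : BoundaryMixing' ↔ BoundaryMixing := Iff.rfl` (the primed form is
  the crux with its `let`s zeta-reduced into the §1 vocabulary, definitionally equal).

## Disproof / negatives used
* `Cruxes/BoundaryMixing/Disproof.lean`: none exists (`ledger crux ls stmt-CriticalPhenomena-4847`: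
  "no workfiles yet", 2026-08-17) — no `_false_without_` obstruction to honour, no landed
  `Theorems/BoundaryMixing/Negative/*`.
* `ledger negatives --problem CriticalPhenomena` (11 entries, 2026-08-17): the only SAW-law entry is
  stmt-0772 (`IsTightLaws` over ALL `δ ∈ (0,1]`, refuted by far-away coincident endpoints at
  `δ > 1/2`); avoided in kind — every statement here is EVENTUAL in `δ` (`∀ᶠ δ in 𝓝[>] 0`) and
  pinning data are re-quantified at each `δ` (mesh points inside the gates, endpoints joined), so
  no all-`δ` or far-endpoint witness applies.  No other negative concerns chordal SAW laws or the
  polygon gas.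
* Vacuity / junk pass: `IsPinning` demands `Reachable u v` in `Ω'_δ`, so `SAW.law Ω' δ u v` is never
  the junk measure `0` on admissible data (else `PinningMixing` would be trivially FALSE against
  the reference data); for `ε < |a − b|/2` the two gates are disjoint, so `u ≠ v`; `K = ∅` is
  allowed and harmless (`P = 1 = q`); `GateMixture` is existential in the pinning data but cannot
  be met by degenerate witnesses (`P^{g} ∈ {0,1}` is impossible for honest laws and `K` with
  nonempty interior), and it silently asserts `ν_δ(G_ε) > 0` eventually (error term (iii)).
-/

noncomputable section

open scoped BigOperators Topology Classical MeasureTheory ENNReal NNReal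
open Filter Set TopologicalSpace MeasureTheory
open Literature.Probability.RandomPlanarGeometry Literature.Probability.LatticeModels

namespace Summit.CriticalPhenomena.SAWScalingLimit.Cruxes.BoundaryMixing.Birth

/-! ### 1. Vocabulary (verbatim from the crux) -/

/-- The closed-edge TRACE in `ℂ` of a finite edge set `E` of `ℤ²` at mesh `δ`: the union of the
segments `[δx, δy]`, `s(x,y) ∈ E`.  VERBATIM the crux's `let tr`. -/
def trace (δ : ℝ) (E : Finset (Sym2 (Site 2))) : Set ℂ :=
  {p : ℂ | ∃ x y : Site 2, s(x, y) ∈ E ∧ p ∈ segment ℝ (meshPoint δ x) (meshPoint δ y)}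

/-- The critical POLYGON-GAS MASS of a trace event `P` at mesh `δ`:
`ν_δ(P) = Σ_{E polygon of ℤ², P(trace_δ E)} x_c^{#E}`.  VERBATIM the crux's `let M`. -/
def mass (δ : ℝ) (P : Set ℂ → Prop) : ℝ :=
  ∑' E : Finset (Sym2 (Site 2)),
    (if SAW.IsPolygon (zdGraph 2) E ∧ P (trace δ E) then SAW.criticalFugacity ^ E.card else (0 : ℝ))

/-- The TWO-GATE EVENT `G_ε` of the crux for the Dobrushin domain `D = (Ω; a, b)` and window radius
`R`: trace inside `B(0,R)`, no contact with `∂Ω` outside the open gates `B(a,ε) ∪ B(b,ε)`, meets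
`Ω` away from the closed gates, meets the exterior away from `Ω̄` and the closed gates, meets both
gates.  VERBATIM the crux's `let G`. -/
def gate (D : DobrushinDomain) (R ε : ℝ) (T : Set ℂ) : Prop :=
  T ⊆ Metric.ball (0 : ℂ) R ∧
  T ∩ (frontier D.carrier \ (Metric.ball (D.pt 0) ε ∪ Metric.ball (D.pt 1) ε)) = ∅ ∧
  (T ∩ (D.carrier \ closure (Metric.ball (D.pt 0) ε ∪ Metric.ball (D.pt 1) ε))).Nonempty ∧
  (T ∩ (closure D.carrier ∪ closure (Metric.ball (D.pt 0) ε ∪ Metric.ball (D.pt 1) ε))ᶜ).Nonempty ∧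
  (T ∩ Metric.ball (D.pt 0) ε).Nonempty ∧ (T ∩ Metric.ball (D.pt 1) ε).Nonempty

/-- The GAS RATIO `q_ε(δ) = ν_δ(G_ε ∩ {T ∩ K = ∅}) / ν_δ(G_ε)` (the crux's right-hand term; junk
`0` if `ν_δ(G_ε) = 0`). -/
def gasRatio (D : DobrushinDomain) (R ε δ : ℝ) (K : Set ℂ) : ℝ :=
  mass δ (fun T => gate D R ε T ∧ T ∩ K = ∅) / mass δ (gate D R ε)

/-- The chordal AVOIDANCE PROBABILITY `P^{SAW(Ω'_δ; u, v)}(range γ ∩ K = ∅)` of the critical SAW law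
of the discrete domain `Ω'_δ` from `u` to `v` (the crux's left-hand term when `Ω' = Ω`, `u = a_δ`,
`v = b_δ`). -/
def avoidProb (Ω : Set ℂ) (δ : ℝ) (u v : Site 2) (K : Set ℂ) : ℝ :=
  ((SAW.law Ω δ u v) {γ | γ.curve.range ∩ K = ∅}).toReal

/-- PINNING DATA at gate radius `ρ` and mesh `δ` for `D = (Ω; a, b)`: a sub-domain `Ω' ⊆ Ω` equal
to `Ω` off the closed `ρ`-gates (only a gate-local excision is allowed), and lattice endpoints
`u, v` with mesh points in the `ρ`-gates at `a = D.pt 0` resp. `b = D.pt 1`, joined in the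
discrete domain `Ω'_δ` (so that `SAW.law Ω' δ u v` is a probability law, not junk).  This is what
cutting a gate-crossing polygon along `∂Ω` leaves for its macroscopic inside arc: `Ω' = Ω` minus
the vertices of the other (gate-confined) inside pieces, `u, v` the first/last lattice vertices
inside `Ω` (within `ε + δ < 2ε` of `a`, `b`). -/
def IsPinning (D : DobrushinDomain) (ρ δ : ℝ) (Ω : Set ℂ) (u v : Site 2) : Prop :=
  Ω ⊆ D.carrier ∧
  D.carrier \ closure (Metric.ball (D.pt 0) ρ ∪ Metric.ball (D.pt 1) ρ) ⊆ Ω ∧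
  meshPoint δ u ∈ Metric.ball (D.pt 0) ρ ∧ meshPoint δ v ∈ Metric.ball (D.pt 1) ρ ∧
  (discreteDomainGraph Ω δ).Reachable u v

/-- STUB 1 statement — **gate mixture (the cutting identity, averaged)**: for every Dobrushin
domain, window `B(0,R) ⊇ Ω̄`, compact regular-closed `K ⊆ Ω` and `η > 0` there is `ε₀ > 0` such
that for all `ε ∈ (0, ε₀)`, eventually as `δ → 0⁺`, some pinning data `g₁, g₂` at gate radius
`2ε` sandwich the gas ratio: `P^{g₁}(avoid K) − η ≤ q_ε(δ) ≤ P^{g₂}(avoid K) + η`. -/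
def GateMixture : Prop :=
  ∀ (D : DobrushinDomain) (R : ℝ), closure D.carrier ⊆ Metric.ball (0 : ℂ) R →
    ∀ K : Set ℂ, IsCompact K → K ⊆ D.carrier → closure (interior K) = K →
    ∀ η : ℝ, 0 < η → ∃ ε₀ : ℝ, 0 < ε₀ ∧ ∀ ε : ℝ, 0 < ε → ε < ε₀ →
      ∀ᶠ δ : ℝ in nhdsWithin (0 : ℝ) (Set.Ioi 0),
        ∃ (Ω₁ Ω₂ : Set ℂ) (u₁ v₁ u₂ v₂ : Site 2),
          IsPinning D (2 * ε) δ Ω₁ u₁ v₁ ∧ IsPinning D (2 * ε) δ Ω₂ u₂ v₂ ∧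
          avoidProb Ω₁ δ u₁ v₁ K - η ≤ gasRatio D R ε δ K ∧
          gasRatio D R ε δ K ≤ avoidProb Ω₂ δ u₂ v₂ K + η

/-- STUB 2 statement — **pinning mixing (the macroscopic SAW forgets its pinning)**: for every
Dobrushin domain, compact regular-closed `K ⊆ Ω` and `η > 0` there is `ε₀ > 0` such that for all
`ε ∈ (0, ε₀)`, eventually as `δ → 0⁺`, ANY two pinning data at gate radius `ε` have avoidance
probabilities within `η`: `|P^{g₁}(avoid K) − P^{g₂}(avoid K)| < η` (uniformly over the pinning). -/
def PinningMixing : Prop :=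
  ∀ (D : DobrushinDomain) (K : Set ℂ), IsCompact K → K ⊆ D.carrier → closure (interior K) = K →
    ∀ η : ℝ, 0 < η → ∃ ε₀ : ℝ, 0 < ε₀ ∧ ∀ ε : ℝ, 0 < ε → ε < ε₀ →
      ∀ᶠ δ : ℝ in nhdsWithin (0 : ℝ) (Set.Ioi 0),
        ∀ (Ω₁ Ω₂ : Set ℂ) (u₁ v₁ u₂ v₂ : Site 2),
          IsPinning D ε δ Ω₁ u₁ v₁ → IsPinning D ε δ Ω₂ u₂ v₂ →
          |avoidProb Ω₁ δ u₁ v₁ K - avoidProb Ω₂ δ u₂ v₂ K| < η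

/-- The crux with its three `let`s zeta-reduced into the §1 vocabulary (definitionally the route
decl, see `boundaryMixing_iff`). -/
def BoundaryMixing' : Prop :=
  ∀ (D : DobrushinDomain) (a b : ℝ → Site 2), SAW.IsEndpointApprox D a b →
    ∀ R : ℝ, closure D.carrier ⊆ Metric.ball (0 : ℂ) R →
    ∀ K : Set ℂ, IsCompact K → K ⊆ D.carrier → closure (interior K) = K →
    ∀ η : ℝ, 0 < η → ∃ ε₀ : ℝ, 0 < ε₀ ∧ ∀ ε : ℝ, 0 < ε → ε < ε₀ →
      ∀ᶠ δ : ℝ in nhdsWithin (0 : ℝ) (Set.Ioi 0),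
        |avoidProb D.carrier δ (a δ) (b δ) K - gasRatio D R ε δ K| < η

/-- The primed form IS the route decl: `BoundaryMixing` unfolds (delta, then zeta on `tr`, `M`,
`G`, then delta on the §1 vocabulary) to `BoundaryMixing'`. -/
theorem boundaryMixing_iff :
    BoundaryMixing' ↔ Summit.CriticalPhenomena.SAWScalingLimit.Theses.SAWLoopLift.BoundaryMixing :=
  Iff.rfl

/-! ### 2. The registered stubs (the only `sorry`s of the file) -/

/-- STUB 1 (L): gate mixture — the gas ratio on the two-gate event is, up to `η`, sandwiched by
gate-pinned chordal SAW avoidance probabilities (cutting bijection + multi-passage negligibility +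
boundary-touch negligibility + existence of gate polygons). -/
theorem stub_gateMixture : GateMixture := by
  sorry

/-- STUB 2 (XL, HARDEST): pinning mixing — gate-pinned chordal critical-SAW avoidance probabilities
of a fixed compact `K ⊆ Ω` oscillate by less than `η` over ALL pinning data, `δ → 0⁺` then
`ε → 0⁺`. -/
theorem stub_pinningMixing : PinningMixing := by
  sorry

/-! ### Name-keyed aliases of the stub statements (hypotheses of the composition)

`Registered.stub_X : Prop` is the statement of `stub_X` under the registered stub's short name, so
that the skeleton audit (`#h21_check_skeleton`: hypotheses admissible iff registered stubs BY NAME)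
accepts `BoundaryMixing_of : Registered.stub_… → … → BoundaryMixing` (device of
`Cruxes/ChainLaw/Lines/birth.lean`, `Cruxes/BoundaryClosure/Lines/two-root-quotient.lean`). -/
namespace Registered

/-- Alias keyed by the registered stub name. -/
abbrev stub_gateMixture : Prop := GateMixture
/-- Alias keyed by the registered stub name. -/
abbrev stub_pinningMixing : Prop := PinningMixing

end Registered

/-! ### 3. The sorry-free part: the endpoint-approximation link and the composition -/

/-- **Reference pinning (PROVED glue).** Under an endpoint approximation `(a_δ, b_δ)` of `(Ω; a, b)`
the unperturbed data `(Ω; a_δ, b_δ)` are pinning data at every gate radius `ρ > 0`, eventually in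
`δ`: the mesh points converge to the marked points (`tendsto_fst/snd`) and the endpoints are joined
in `Ω_δ` eventually (`reachable`).  This is the only place the endpoint approximation enters. -/
theorem eventually_isPinning {D : DobrushinDomain} {a b : ℝ → Site 2}
    (hab : SAW.IsEndpointApprox D a b) {ρ : ℝ} (hρ : 0 < ρ) :
    ∀ᶠ δ : ℝ in nhdsWithin (0 : ℝ) (Set.Ioi 0), IsPinning D ρ δ D.carrier (a δ) (b δ) := by
  have ha : ∀ᶠ δ : ℝ in nhdsWithin (0 : ℝ) (Set.Ioi 0), meshPoint δ (a δ) ∈ Metric.ball (D.pt 0) ρ :=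
    hab.tendsto_fst.eventually_mem (Metric.ball_mem_nhds _ hρ)
  have hb : ∀ᶠ δ : ℝ in nhdsWithin (0 : ℝ) (Set.Ioi 0), meshPoint δ (b δ) ∈ Metric.ball (D.pt 1) ρ :=
    hab.tendsto_snd.eventually_mem (Metric.ball_mem_nhds _ hρ)
  filter_upwards [hab.reachable, ha, hb] with δ h1 h2 h3
  exact ⟨Subset.rfl, fun x hx => hx.1, h2, h3, h1⟩

/-- **The composition in the zeta-reduced form** (no `sorry`): gate mixture at slack `η/2` and
pinning mixing at slack `η/2` (applied at gate radius `2ε`, against the reference pinning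
`(Ω; a_δ, b_δ)` supplied by `eventually_isPinning`) give `|P_δ(avoid K) − q_ε(δ)| < η`
eventually in `δ`, for every `ε < min ε₁ (ε₂/2)`. -/
theorem boundaryMixing'_of (h1 : GateMixture) (h2 : PinningMixing) : BoundaryMixing' := by
  intro D a b hab R hR K hK hKD hKreg η hη
  have hη2 : 0 < η / 2 := half_pos hη
  obtain ⟨ε₁, hε₁, H1⟩ := h1 D R hR K hK hKD hKreg (η / 2) hη2
  obtain ⟨ε₂, hε₂, H2⟩ := h2 D K hK hKD hKreg (η / 2) hη2
  refine ⟨min ε₁ (ε₂ / 2), lt_min hε₁ (half_pos hε₂), fun ε hε hεlt => ?_⟩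
  have hε1 : ε < ε₁ := lt_of_lt_of_le hεlt (min_le_left _ _)
  have hε2 : 2 * ε < ε₂ := by
    have := lt_of_lt_of_le hεlt (min_le_right _ _)
    linarith
  have h2ε : 0 < 2 * ε := by positivity
  filter_upwards [H1 ε hε hε1, H2 (2 * ε) h2ε hε2, eventually_isPinning hab h2ε] with δ hδ1 hδ2 hδ0
  obtain ⟨Ω₁, Ω₂, u₁, v₁, u₂, v₂, hg₁, hg₂, hlo, hhi⟩ := hδ1
  have e1 := hδ2 Ω₁ D.carrier u₁ v₁ (a δ) (b δ) hg₁ hδ0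
  have e2 := hδ2 Ω₂ D.carrier u₂ v₂ (a δ) (b δ) hg₂ hδ0
  rw [abs_sub_lt_iff] at e1 e2 ⊢
  constructor <;> linarith [e1.1, e1.2, e2.1, e2.2]

/-- **The composition (kernel-checked, no `sorry`)**: the two stubs imply the crux `BoundaryMixing`
BY NAME. -/
theorem BoundaryMixing_of (h1 : Registered.stub_gateMixture) (h2 : Registered.stub_pinningMixing) :
    Summit.CriticalPhenomena.SAWScalingLimit.Theses.SAWLoopLift.BoundaryMixing :=
  boundaryMixing_iff.mp (boundaryMixing'_of h1 h2)

/-- Wiring check: the registered stubs feed `BoundaryMixing_of` as stated. -/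
example : Summit.CriticalPhenomena.SAWScalingLimit.Theses.SAWLoopLift.BoundaryMixing :=
  BoundaryMixing_of stub_gateMixture stub_pinningMixing

end Summit.CriticalPhenomena.SAWScalingLimit.Cruxes.BoundaryMixing.Birth

end
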